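import Summits.QuantumAdvantage.AdviceFreeQNC0.AffBells21GenericPath
import HarnessLib

/-!
# Cell qa-qnc0, plan S2 cube side: averaging the leaf potential over uniformly random coefficient matrices

Support for crux `RingDenseResidualLt3` (stmt-QuantumAdvantage-22907), route `DWalkThree`; planner qa-qnc0-p1 g21
ROUND-20 §2.8 (P2-generic): "a row survives a level iff `α_k(x) ≠ α_k(x')`, an event of probability exactly `2/3` in
the pair's entries and independent of the other columns, so a leaf is a uniformly random system … and
`E_B Φ(leaf) ≤ 3^{−s'} + (5/3)^{s'}(2/3)^{q−6}`".  Kernel form, as exact finite sums over all `B ∈ 𝔽₃^{s × q}`: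

* `splitEquiv` / `sum_split` — a matrix is its six distinguished columns `P ∈ 𝔽₃^{s×6}` and the rest
  `Q ∈ 𝔽₃^{s×(q−6)}` (`mergeCols`); survivors read only `P` (`survS_mergeCols`), the off-six weight only `Q`
  (`wtR_mergeCols`).
* `three_mul_card_orth` — a non-zero linear form on `𝔽₃^s` vanishes on exactly `3^{s−1}` vectors (orthogonality of
  characters, `TwoModuli.sum_stdAddChar_dot_eq_ite`), whence the one-column factor `Σ_col 2^{−[⟨ξ,col⟩≠0]} = (2/3)3^s`
  (`sum_col_weight`) and `Σ_Q 2^{−wt(ξQ)} = ((2/3)3^s)^{q−6}` for `ξ ≠ 0` (`sum_Q_weight`, column by column).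
* `sum_supp_two_pow_wt` — `Σ_{supp ξ ⊆ S} 2^{wt ξ} = 5^{|S|}`; `sum_row_factor` — `Σ_{row ∈ 𝔽₃^6}(5/3)^{[row₀row₂row₄≠0]}
  = 873 = 729·(97/81)`; `sum_P_pow_surv` — `Σ_P (5/3)^{|S(P)|} = 873^s`; `sum_P_surv_empty` — `Σ_P [S(P) = ∅] = 513^s`.
* **`sum_Psi_le`** — `Σ_B Ψ(B) ≤ (2/3)^{q−6} (97/81)^s 3^{sq}` (the Markov numerator; `(97/81)²·(2/3) < 1` is the
  decay at `s = 2q`) and **`sum_surv_empty`** — `#{B : S(B) = ∅} = (19/27)^s 3^{sq}`.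

WHAT THIS IS NOT: the rung itself (`AffBells21Generic.lean`); nothing here touches the crux.
-/

namespace Summit.QuantumAdvantage.AdviceFreeQNC0

open Finset
open Literature.Computability.MetaComplexity

namespace AffBells21

variable {q s : ℕ}

/-! ## Splitting the columns: the six distinguished coins and the rest -/

/-- The off-six coins. -/
abbrev OffSix (q : ℕ) := {j : Fin q // ¬ (j.val < 6)}

/-- Merge a six-column part and an off-six part. -/
def mergeCols (P : Fin s → Fin 6 → ZMod 3) (Q : Fin s → OffSix q → ZMod 3) : Fin s → Fin q → ZMod 3 :=
  fun k j => if h : j.val < 6 then P k ⟨j.val, h⟩ else Q k ⟨j, h⟩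

section Split

variable (hq : 6 ≤ q)

/-- The six distinguished columns of a merged matrix. -/
theorem mergeCols_cix (P : Fin s → Fin 6 → ZMod 3) (Q : Fin s → OffSix q → ZMod 3) (k : Fin s) (i : Fin 6) :
    mergeCols P Q k (cix hq i) = P k i := by
  unfold mergeCols
  have h : (cix hq i).val < 6 := i.2
  rw [dif_pos h]
  exact congrArg (P k) (Fin.ext rfl)

/-- The off-six columns of a merged matrix. -/
theorem mergeCols_off (P : Fin s → Fin 6 → ZMod 3) (Q : Fin s → OffSix q → ZMod 3) (k : Fin s) (j : OffSix q) :
    mergeCols P Q k j.1 = Q k j := by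
  unfold mergeCols
  rw [dif_neg j.2]

/-- The column-splitting equivalence. -/
def splitEquiv : (Fin s → Fin q → ZMod 3) ≃ (Fin s → Fin 6 → ZMod 3) × (Fin s → OffSix q → ZMod 3) where
  toFun B := (fun k i => B k (cix hq i), fun k j => B k j.1)
  invFun PQ := mergeCols PQ.1 PQ.2
  left_inv B := by
    funext k j
    show mergeCols (fun k i => B k (cix hq i)) (fun k j => B k j.1) k j = B k j
    unfold mergeCols
    split_ifs with h
    · congr 1
    · rfl
  right_inv PQ := by
    rcases PQ with ⟨P, Q⟩
    simp only [Prod.mk.injEq]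
    exact ⟨funext fun k => funext fun i => mergeCols_cix hq P Q k i,
      funext fun k => funext fun j => mergeCols_off P Q k j⟩

include hq in
/-- Summing over matrices = summing over the two column parts. -/
theorem sum_split (f : (Fin s → Fin q → ZMod 3) → ℝ) :
    ∑ B : Fin s → Fin q → ZMod 3, f B
      = ∑ P : Fin s → Fin 6 → ZMod 3, ∑ Q : Fin s → OffSix q → ZMod 3, f (mergeCols P Q) := by
  rw [← (splitEquiv hq).symm.sum_comp, Fintype.sum_prod_type]
  rfl

/-- Survivors read only the six-column part. -/
def survP (P : Fin s → Fin 6 → ZMod 3) : Finset (Fin s) :=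
  univ.filter fun k => P k 0 ≠ 0 ∧ P k 2 ≠ 0 ∧ P k 4 ≠ 0

/-- Survivors of a merged matrix. -/
theorem survS_mergeCols (P : Fin s → Fin 6 → ZMod 3) (Q : Fin s → OffSix q → ZMod 3) :
    survS hq (mergeCols P Q) = survP P := by
  unfold survS survP
  simp only [mergeCols_cix]

/-- Off-six weight in the off-six coordinates. -/
def wtQ (ξ : Fin s → ZMod 3) (Q : Fin s → OffSix q → ZMod 3) : ℕ :=
  (univ.filter fun j : OffSix q => (∑ k : Fin s, ξ k * Q k j) ≠ 0).card

/-- Off-six weight of a merged matrix. -/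
theorem wtR_mergeCols (ξ : Fin s → ZMod 3) (P : Fin s → Fin 6 → ZMod 3) (Q : Fin s → OffSix q → ZMod 3) :
    wtR ξ (mergeCols P Q) = wtQ ξ Q := by
  unfold wtR wtQ
  rw [← Fintype.card_subtype, ← Fintype.card_subtype]
  refine Fintype.card_congr ((Equiv.subtypeSubtypeEquivSubtypeInter (fun j : Fin q => ¬ (j.val < 6))
    (fun j => (∑ k : Fin s, ξ k * mergeCols P Q k j) ≠ 0)).symm.trans ?_)
  refine Equiv.subtypeEquivRight fun j => ?_
  simp only [mergeCols_off]

/-! ## The sum over the off-six part -/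

/-- `Σ_Q 2^{−wtQ(ξ,Q)} = ((2/3)·3^s)^{#off-six coins}` for `ξ ≠ 0` (column by column). -/
theorem sum_Q_weight (ξ : Fin s → ZMod 3) (hξ : ξ ≠ 0) :
    ∑ Q : Fin s → OffSix q → ZMod 3, (2 : ℝ)⁻¹ ^ wtQ ξ Q
      = (2 / 3 * (3 : ℝ) ^ s) ^ Fintype.card (OffSix q) := by
  unfold wtQ
  simp_rw [pow_card_filter_eq_prod_ite]
  rw [← (Equiv.piComm (fun (j : OffSix q) (k : Fin s) => ZMod 3)).sum_comp]
  have h : ∀ Q' : OffSix q → Fin s → ZMod 3,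
      (∏ j : OffSix q, if (∑ k : Fin s, ξ k * (Equiv.piComm (fun (j : OffSix q) (k : Fin s) => ZMod 3)) Q' k j) ≠ 0
        then (2 : ℝ)⁻¹ else 1)
        = ∏ j : OffSix q, (fun (j : OffSix q) (col : Fin s → ZMod 3) =>
            if (∑ k : Fin s, ξ k * col k) ≠ 0 then (2 : ℝ)⁻¹ else 1) j (Q' j) := fun Q' => rfl
  simp_rw [h]
  rw [← Fintype.prod_sum (fun (j : OffSix q) (col : Fin s → ZMod 3) =>
    if (∑ k : Fin s, ξ k * col k) ≠ 0 then (2 : ℝ)⁻¹ else 1)]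
  simp_rw [sum_col_weight ξ hξ]
  rw [prod_const, card_univ]

include hq in
/-- Number of off-six coins. -/
theorem card_offSix : Fintype.card (OffSix q) = q - 6 := by
  rw [Fintype.card_subtype_compl, Fintype.card_fin, Fintype.card_fin_lt_of_le hq]

include hq in
/-- Number of off-six parts. -/
theorem card_Q : (Fintype.card (Fin s → OffSix q → ZMod 3) : ℝ) = ((3 : ℝ) ^ s) ^ (q - 6) := by
  rw [Fintype.card_fun, Fintype.card_fun, ZMod.card, Fintype.card_fin, card_offSix hq]
  push_cast
  rw [← pow_mul, ← pow_mul, mul_comm]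

/-! ## The sum over the six-column part -/

/-- `Σ_{supp ξ ⊆ S} 2^{wt ξ} = 5^{|S|}`. -/
theorem sum_supp_two_pow_wt (S : Finset (Fin s)) :
    ∑ ξ ∈ (univ : Finset (Fin s → ZMod 3)).filter (fun ξ => ∀ k, k ∉ S → ξ k = 0), (2 : ℝ) ^ wt3 ξ
      = (5 : ℝ) ^ S.card := by
  set f : Fin s → ZMod 3 → ℝ := fun k a => if k ∈ S then (if a ≠ 0 then 2 else 1) else (if a = 0 then 1 else 0)
    with hf
  have hpt : ∀ ξ : Fin s → ZMod 3,
      (if (∀ k, k ∉ S → ξ k = 0) then (2 : ℝ) ^ wt3 ξ else 0) = ∏ k, f k (ξ k) := by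
    intro ξ
    by_cases hsupp : ∀ k, k ∉ S → ξ k = 0
    · rw [if_pos hsupp]
      unfold wt3
      rw [pow_card_filter_eq_prod_ite]
      refine prod_congr rfl fun k _ => ?_
      simp only [hf]
      by_cases hk : k ∈ S
      · simp [hk]
      · have h0 := hsupp k hk
        simp [hk, h0]
    · rw [if_neg hsupp]
      push Not at hsupp
      obtain ⟨k₀, hk₀S, hk₀⟩ := hsupp
      symm
      apply prod_eq_zero (mem_univ k₀)
      simp [hf, hk₀S, hk₀]
  rw [sum_filter, sum_congr rfl fun ξ _ => hpt ξ, ← Fintype.prod_sum f]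
  have h10 : (1 : ZMod 3) ≠ 0 := by decide
  have h20 : (2 : ZMod 3) ≠ 0 := by decide
  have hk : ∀ k : Fin s, ∑ a : ZMod 3, f k a = if k ∈ S then 5 else 1 := by
    intro k
    rw [sum_zmod3_real]
    simp only [hf]
    by_cases hkS : k ∈ S
    · simp [hkS, h10, h20]; norm_num
    · simp [hkS, h10, h20]
  simp_rw [hk]
  rw [prod_ite, prod_const_one, mul_one, prod_const, Finset.filter_univ_mem]

/-- The per-row factor: `Σ_{row ∈ 𝔽₃^6} (5/3)^{[row₀row₂row₄ ≠ 0]} = 873`. -/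
theorem sum_row_factor :
    ∑ row : Fin 6 → ZMod 3, (if (row 0 ≠ 0 ∧ row 2 ≠ 0 ∧ row 4 ≠ 0) then (5 / 3 : ℝ) else 1) = 873 := by
  have h10 : (1 : ZMod 3) ≠ 0 := by decide
  have h20 : (2 : ZMod 3) ≠ 0 := by decide
  -- indicator of the three non-vanishings as a product over the six coordinates
  set ind : ZMod 3 → ℝ := fun a => if a ≠ 0 then 1 else 0 with hind_def
  set one : ZMod 3 → ℝ := fun _ => 1 with hone_def
  set g : Fin 6 → ZMod 3 → ℝ := ![ind, one, ind, one, ind, one] with hg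
  have g0 : g 0 = ind := rfl
  have g1 : g 1 = one := rfl
  have g2 : g 2 = ind := rfl
  have g3 : g 3 = one := rfl
  have g4 : g 4 = ind := rfl
  have g5 : g 5 = one := rfl
  have hind : ∀ row : Fin 6 → ZMod 3,
      (if (row 0 ≠ 0 ∧ row 2 ≠ 0 ∧ row 4 ≠ 0) then (5 / 3 : ℝ) else 1) = 1 + 2 / 3 * ∏ i, g i (row i) := by
    intro row
    rw [Fin.prod_univ_six, g0, g1, g2, g3, g4, g5]
    simp only [hind_def, hone_def]
    by_cases h0 : row 0 = 0 <;> by_cases h2 : row 2 = 0 <;> by_cases h4 : row 4 = 0 <;>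
      simp [h0, h2, h4]
    all_goals norm_num
  have hsum_ind : ∑ a : ZMod 3, ind a = 2 := by
    rw [sum_zmod3_real]
    simp only [hind_def]
    simp [h10, h20]
    norm_num
  have hsum_one : ∑ a : ZMod 3, one a = 3 := by
    rw [sum_zmod3_real]
    simp only [hone_def]
    norm_num
  rw [sum_congr rfl fun row _ => hind row, sum_add_distrib, sum_const, card_univ, ← mul_sum,
    ← Fintype.prod_sum g, Fin.prod_univ_six, g0, g1, g2, g3, g4, g5, hsum_ind, hsum_one,
    Fintype.card_fun, ZMod.card, Fintype.card_fin]
  norm_num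

/-- `Σ_P (5/3)^{|S(P)|} = 873^s`. -/
theorem sum_P_pow_surv :
    ∑ P : Fin s → Fin 6 → ZMod 3, (5 / 3 : ℝ) ^ (survP P).card = (873 : ℝ) ^ s := by
  unfold survP
  simp_rw [pow_card_filter_eq_prod_ite]
  have h : ∀ P : Fin s → Fin 6 → ZMod 3,
      (∏ k : Fin s, if (P k 0 ≠ 0 ∧ P k 2 ≠ 0 ∧ P k 4 ≠ 0) then (5 / 3 : ℝ) else 1)
        = ∏ k : Fin s, (fun (_ : Fin s) (row : Fin 6 → ZMod 3) =>
            if (row 0 ≠ 0 ∧ row 2 ≠ 0 ∧ row 4 ≠ 0) then (5 / 3 : ℝ) else 1) k (P k) := fun P => rfl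
  simp_rw [h]
  rw [← Fintype.prod_sum (fun (_ : Fin s) (row : Fin 6 → ZMod 3) =>
      if (row 0 ≠ 0 ∧ row 2 ≠ 0 ∧ row 4 ≠ 0) then (5 / 3 : ℝ) else 1),
    prod_const, card_univ, Fintype.card_fin, sum_row_factor]

/-- `#{P : S(P) = ∅} · ... `: `Σ_P [S(P) = ∅] = 513^s`. -/
theorem sum_P_surv_empty :
    ∑ P : Fin s → Fin 6 → ZMod 3, (if survP P = ∅ then (1 : ℝ) else 0) = (513 : ℝ) ^ s := by
  have h : ∀ P : Fin s → Fin 6 → ZMod 3, (if survP P = ∅ then (1 : ℝ) else 0)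
      = ∏ k : Fin s, (fun (_ : Fin s) (row : Fin 6 → ZMod 3) =>
          if ¬ (row 0 ≠ 0 ∧ row 2 ≠ 0 ∧ row 4 ≠ 0) then (1 : ℝ) else 0) k (P k) := by
    intro P
    by_cases hS : survP P = ∅
    · rw [if_pos hS]
      symm
      refine prod_eq_one fun k _ => ?_
      have hk : ¬ (P k 0 ≠ 0 ∧ P k 2 ≠ 0 ∧ P k 4 ≠ 0) := by
        intro hc
        have : k ∈ survP P := by unfold survP; simp only [mem_filter, mem_univ, true_and]; exact hc
        rw [hS] at this
        exact absurd this (Finset.notMem_empty k)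
      exact if_pos hk
    · rw [if_neg hS]
      obtain ⟨k₀, hk₀⟩ := Finset.nonempty_iff_ne_empty.mpr hS
      have hc : P k₀ 0 ≠ 0 ∧ P k₀ 2 ≠ 0 ∧ P k₀ 4 ≠ 0 := by
        unfold survP at hk₀; simpa using hk₀
      symm
      apply prod_eq_zero (mem_univ k₀)
      exact if_neg (not_not.mpr hc)
  simp_rw [h]
  rw [← Fintype.prod_sum (fun (_ : Fin s) (row : Fin 6 → ZMod 3) =>
      if ¬ (row 0 ≠ 0 ∧ row 2 ≠ 0 ∧ row 4 ≠ 0) then (1 : ℝ) else 0),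
    prod_const, card_univ, Fintype.card_fin]
  congr 1
  have h873 := sum_row_factor
  have hsplit : ∀ row : Fin 6 → ZMod 3,
      (if ¬ (row 0 ≠ 0 ∧ row 2 ≠ 0 ∧ row 4 ≠ 0) then (1 : ℝ) else 0)
        = 5 / 2 - 3 / 2 * (if (row 0 ≠ 0 ∧ row 2 ≠ 0 ∧ row 4 ≠ 0) then (5 / 3 : ℝ) else 1) := by
    intro row
    split_ifs <;> norm_num
  rw [sum_congr rfl fun row _ => hsplit row, sum_sub_distrib, ← mul_sum, h873, sum_const, card_univ,
    Fintype.card_fun, ZMod.card, Fintype.card_fin]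
  norm_num

/-! ## The two averaged bounds -/

/-- **Markov numerator**: `Σ_B Ψ(B) ≤ (2/3)^{q−6} · (97/81)^s · 3^{sq}`. -/
theorem sum_Psi_le :
    ∑ B : Fin s → Fin q → ZMod 3, Psi hq B
      ≤ (2 / 3 : ℝ) ^ (q - 6) * (97 / 81 : ℝ) ^ s * ((3 : ℝ) ^ s) ^ q := by
  -- Ψ as a sum over all ξ ≠ 0 with an indicator, then swap
  have hPsi : ∀ B : Fin s → Fin q → ZMod 3, Psi hq B
      = ∑ ξ ∈ (univ : Finset (Fin s → ZMod 3)).filter (fun ξ => ξ ≠ 0),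
          (if (∀ k, k ∉ survS hq B → ξ k = 0) then
            (3 : ℝ)⁻¹ ^ (survS hq B).card * (2 : ℝ) ^ wt3 ξ * (2 : ℝ)⁻¹ ^ wtR ξ B else 0) := by
    intro B
    unfold Psi
    rw [sum_filter, sum_filter]
    refine sum_congr rfl fun ξ _ => ?_
    by_cases h1 : ξ ≠ 0 <;> by_cases h2 : (∀ k, k ∉ survS hq B → ξ k = 0) <;> simp [h1, h2]
  rw [sum_congr rfl fun B _ => hPsi B, sum_comm]
  -- each ξ ≠ 0: split the columns
  have hξ : ∀ ξ ∈ (univ : Finset (Fin s → ZMod 3)).filter (fun ξ => ξ ≠ 0),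
      ∑ B : Fin s → Fin q → ZMod 3,
        (if (∀ k, k ∉ survS hq B → ξ k = 0) then
          (3 : ℝ)⁻¹ ^ (survS hq B).card * (2 : ℝ) ^ wt3 ξ * (2 : ℝ)⁻¹ ^ wtR ξ B else 0)
        = (∑ P : Fin s → Fin 6 → ZMod 3,
            (if (∀ k, k ∉ survP P → ξ k = 0) then (3 : ℝ)⁻¹ ^ (survP P).card * (2 : ℝ) ^ wt3 ξ else 0))
          * (2 / 3 * (3 : ℝ) ^ s) ^ Fintype.card (OffSix q) := by
    intro ξ hξmem
    have hξ0 : ξ ≠ 0 := (mem_filter.mp hξmem).2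
    rw [sum_split hq, sum_mul]
    refine sum_congr rfl fun P _ => ?_
    simp_rw [survS_mergeCols hq, wtR_mergeCols]
    rw [← sum_Q_weight ξ hξ0]
    by_cases hs : ∀ k, k ∉ survP P → ξ k = 0
    · simp only [if_pos hs, mul_sum]
    · simp only [if_neg hs, zero_mul, sum_const_zero]
  rw [sum_congr rfl hξ, ← sum_mul]
  -- the six-column part: swap back and use `Σ_{supp ⊆ S} 2^wt = 5^|S|`
  have hP : ∑ ξ ∈ (univ : Finset (Fin s → ZMod 3)).filter (fun ξ => ξ ≠ 0),
      ∑ P : Fin s → Fin 6 → ZMod 3,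
        (if (∀ k, k ∉ survP P → ξ k = 0) then (3 : ℝ)⁻¹ ^ (survP P).card * (2 : ℝ) ^ wt3 ξ else 0)
      ≤ (873 : ℝ) ^ s := by
    rw [sum_comm, ← sum_P_pow_surv]
    refine sum_le_sum fun P _ => ?_
    calc ∑ ξ ∈ (univ : Finset (Fin s → ZMod 3)).filter (fun ξ => ξ ≠ 0),
          (if (∀ k, k ∉ survP P → ξ k = 0) then (3 : ℝ)⁻¹ ^ (survP P).card * (2 : ℝ) ^ wt3 ξ else 0)
        ≤ ∑ ξ : Fin s → ZMod 3,
          (if (∀ k, k ∉ survP P → ξ k = 0) then (3 : ℝ)⁻¹ ^ (survP P).card * (2 : ℝ) ^ wt3 ξ else 0) :=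
          sum_le_sum_of_subset_of_nonneg (filter_subset _ _) (fun ξ _ _ => by split_ifs <;> positivity)
      _ = (3 : ℝ)⁻¹ ^ (survP P).card * ∑ ξ ∈ (univ : Finset (Fin s → ZMod 3)).filter
            (fun ξ => ∀ k, k ∉ survP P → ξ k = 0), (2 : ℝ) ^ wt3 ξ := by
          rw [sum_filter, mul_sum]
          refine sum_congr rfl fun ξ _ => ?_
          split_ifs <;> simp
      _ = (5 / 3 : ℝ) ^ (survP P).card := by
          rw [sum_supp_two_pow_wt, ← mul_pow]
          norm_num
  have hW : (0 : ℝ) ≤ (2 / 3 * (3 : ℝ) ^ s) ^ Fintype.card (OffSix q) := by positivity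
  calc (∑ ξ ∈ (univ : Finset (Fin s → ZMod 3)).filter (fun ξ => ξ ≠ 0),
        ∑ P : Fin s → Fin 6 → ZMod 3,
          (if (∀ k, k ∉ survP P → ξ k = 0) then (3 : ℝ)⁻¹ ^ (survP P).card * (2 : ℝ) ^ wt3 ξ else 0))
        * (2 / 3 * (3 : ℝ) ^ s) ^ Fintype.card (OffSix q)
      ≤ (873 : ℝ) ^ s * (2 / 3 * (3 : ℝ) ^ s) ^ Fintype.card (OffSix q) := mul_le_mul_of_nonneg_right hP hW
    _ = (2 / 3 : ℝ) ^ (q - 6) * (97 / 81 : ℝ) ^ s * ((3 : ℝ) ^ s) ^ q := by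
        rw [card_offSix hq, mul_pow]
        have h873 : (873 : ℝ) ^ s = (97 / 81 : ℝ) ^ s * ((3 : ℝ) ^ s) ^ 6 := by
          rw [← pow_mul, mul_comm s 6, pow_mul, ← mul_pow]
          norm_num
        have h3q : ((3 : ℝ) ^ s) ^ q = ((3 : ℝ) ^ s) ^ 6 * ((3 : ℝ) ^ s) ^ (q - 6) := by
          rw [← pow_add]; congr 1; omega
        rw [h873, h3q]
        ring

/-- **Empty survivor sets**: `#{B : S(B) = ∅} = (19/27)^s · 3^{sq}`. -/
theorem sum_surv_empty :
    ∑ B : Fin s → Fin q → ZMod 3, (if survS hq B = ∅ then (1 : ℝ) else 0)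
      = (19 / 27 : ℝ) ^ s * ((3 : ℝ) ^ s) ^ q := by
  rw [sum_split hq]
  simp_rw [survS_mergeCols hq]
  simp_rw [sum_const, card_univ]
  rw [← smul_sum, sum_P_surv_empty, nsmul_eq_mul, card_Q hq]
  have h513 : (513 : ℝ) ^ s = (19 / 27 : ℝ) ^ s * ((3 : ℝ) ^ s) ^ 6 := by
    rw [← pow_mul, mul_comm s 6, pow_mul, ← mul_pow]
    norm_num
  have h3q : ((3 : ℝ) ^ s) ^ q = ((3 : ℝ) ^ s) ^ 6 * ((3 : ℝ) ^ s) ^ (q - 6) := by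
    rw [← pow_add]; congr 1; omega
  rw [h513, h3q]
  ring

end Split

end AffBells21

end Summit.QuantumAdvantage.AdviceFreeQNC0
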